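import Summits.BirchSwinnertonDyer.BirchSwinnertonDyer.Theses.PrintX6
import Literature.NumberTheory.EllipticCurves.Wuthrich2014.ThreeAdicImageSupersingularProofs
import HarnessLib

/-!
# Route `PrintX6`, glue item `PublishedInputsX6OfParts` (stmt-BirchSwinnertonDyer-20376): the eight
# shared by-name input items give the route's nine-fold `PublishedInputsX6` — PROVED

HONEST FRAMING (cell `bsd-print-x6`, run/shared/lean/pub/bsd-print-x6/; PRINT tier D-0131 (2);
prover p2, as assigned by the planner 13:27Z). THEOREMS ONLY; conjunction bookkeeping; nothing about
any curve is asserted; none of the eight inputs is proved here — they are the route's published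
hypotheses (Kobayashi 2003 Thm. 1.2 / Thm. 4.1, B. D. Kim 2013 Cor. 3.15, the period units at
`p ≥ 5` and at `3`, modularity ×2, GZK), each a definitional alias `Input…` of the named fact
(`Theses/PrintX6.lean`, split gen 1 of stmt-20302). The NINTH conjunct of `PublishedInputsX6`,
Wuthrich 2014 Lemma 20 (`Wuthrich2014.lemma20_surjective_threeAdic_of_semistable`: `3² ∤ N`,
`ρ̄_{E,3}` onto ⇒ `ρ̄_{E,3ⁿ}` onto for all `n`), is a tree THEOREM —
`Wuthrich2014.lemma20_surjective_threeAdic_of_semistable_holds`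
(`Wuthrich2014/ThreeAdicImageSupersingularProofs.lean`, local proof at `3`) — so it is supplied, not
assumed. [cite: Wuthrich2014, Lemma 20 (p. 399)]
-/

set_option autoImplicit false
-- the landed namespace `Summit.BirchSwinnertonDyer.BirchSwinnertonDyer.Theorems` (summit = problem) trips the linter
set_option linter.dupNamespace false

noncomputable section

open Literature.NumberTheory.EllipticCurves
  Summit.BirchSwinnertonDyer.BirchSwinnertonDyer.Theses.PrintX6

namespace Summit.BirchSwinnertonDyer.BirchSwinnertonDyer.Theorems

/-- **Route `PrintX6`, glue `PublishedInputsX6OfParts` (stmt-BirchSwinnertonDyer-20376), PROVED**: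
`InputKobayashiThm12 → InputKobayashiThm41 → InputKimCor315 → InputPeriodUnit →
InputPeriodUnitThree → InputModularParametrization → InputEntireLFunction → InputGZK →
PublishedInputsX6` — conjunction introduction, the sixth conjunct (Wuthrich 2014 Lemma 20) being the
tree theorem `Wuthrich2014.lemma20_surjective_threeAdic_of_semistable_holds`.
[cite: Wuthrich2014, Lemma 20 (p. 399)] -/
theorem publishedInputsX6OfParts_proof :
    Summit.BirchSwinnertonDyer.BirchSwinnertonDyer.Theses.PrintX6.PublishedInputsX6OfParts := by
  intro h12 h41 h315 hper hper3 hmod hL hGZK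
  exact ⟨h12, h41, h315, hper, hper3, Wuthrich2014.lemma20_surjective_threeAdic_of_semistable_holds,
    hmod, hL, hGZK⟩

/-- **The nine-fold `PublishedInputsX6` from the EIGHT named facts directly** (same content, the
`Input…` aliases unfolded): Kobayashi Thm. 1.2, Thm. 4.1, Kim Cor. 3.15, period units at `p ≥ 5` /
at `3`, modularity (parametrisation data, entire `L`-function), GZK. [cite: Wuthrich2014, Lemma 20 (p. 399)] -/
theorem publishedInputsX6_of_facts
    (h12 : Kobayashi2003.thm12_signedSelmerDual_finite_torsion)
    (h41 : Kobayashi2003.thm41_signedCharIdeal_divisibility)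
    (hKim : BDKim2013.cor315_signedCharValue_rankZero)
    (h5 : realPeriodRat_eq_unit_mul_plusPeriod) (h3 : realPeriodRat_eq_unit_mul_plusPeriod_three)
    (hmod : ModularForms.nonempty_modularParametrizationData)
    (hmod' : WeierstrassCurve.hasEntireLFunction_rat)
    (hGZK : rank_eq_analyticRank_of_analyticRank_le_one) : PublishedInputsX6 :=
  publishedInputsX6OfParts_proof h12 h41 hKim h5 h3 hmod hmod' hGZK

end Summit.BirchSwinnertonDyer.BirchSwinnertonDyer.Theorems

end
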